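import Summits.CriticalPhenomena.PercolationContinuityZ3.Theorems.PercNearOneGluingNoHeavyLowerTailSahiE3HittingEvents
import Summits.CriticalPhenomena.PercolationContinuityZ3.Theorems.PercNearOneGluingNoHeavyLowerTailSparseBernsteinCert
import Literature.Probability.LatticeModels.SahiFourthOrderCorrelation
import HarnessLib

/-!
# `NoHeavyLowerTail` (crux stmt-CriticalPhenomena-4575), Sahi programme P5: Sahi's `C₄` for four HITTING EVENTS of ANY
# product space — `E₄(H_A,H_B,H_C,H_D) ≥ 0` — by a kernel-checked sparse Bernstein certificate in the 15 Venn regions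

Support file (seat `prim-l12-p5`, gen 6; `--supports stmt-CriticalPhenomena-4575`; COMPUTATIONAL: ONE `native_decide`, the
certificate `hit4_check` (≈ 30 s on the farm); `decide +kernel` for the table identity and the exponent bound; otherwise standard
axioms; the data tables are definitions).  Sequel of `…SahiE3HittingEvents` (order 3, closed form) and `…SparseBernsteinCert`
(the generic certificate and its soundness `SparseBernstein.check_sound` / `evalT_nonneg_of_bcoef`).

THE THEOREM (`prodBernoulli_sahiE4_hit_nonneg`): for every index type `ι`, every `p : ι → [0,1]` and all finite
`A, B, C, D ⊆ ι`, the hitting events `H_S = {ω | ∃ i ∈ S, i ∈ ω}` of `prodBernoulli p` satisfy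
`0 ≤ E₄(H_A,H_B,H_C,H_D)` (Lieb–Sahi's fourth functional, tree `sahiE4`).  Sahi's `C₄` [Sahi2008, Conj. 5; LiebSahi2021,
Conj. 1.1] was known in the tree on the cube `{0,1}⁴` (all product measures, `…SahiC4CubeFour`) and for cumulation / chain /
absorbed configurations; hitting events with `|S| ≥ 2` are none of these, and the number of coordinates here is arbitrary.

MECHANISM.  (1) `H_S = (M_S)ᶜ` with `M_S = {all of S absent}`, `M_S ∩ M_T = M_{S∪T}`, `μ(M_S) = ∏_{i∈S}(1−p_i)`; the tree's
complementation identity `sahiE4_compl` (`E₄(Mᶜ) = E₄(M) − 2ΣE₃(M) + 2ΣE₂(M)`) makes `E₄(H)` a polynomial in the fifteen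
miss-probabilities `Q_𝒮 = ∏_{i ∈ ⋃𝒮} (1 − p_i)`, `∅ ≠ 𝒮 ⊆ {A,B,C,D}`.  (2) VENN REDUCTION: with `r_T = ∏_{i in region T} (1−p_i)` for the
15 regions `T` of the Venn diagram of `A,B,C,D`, `Q_𝒮 = ∏_{T ∩ 𝒮 ≠ ∅} r_T` (fifteen factorisations `fA … fABCD`), so `E₄(H) = P₄(r)`
for ONE polynomial `P₄` in 15 variables — 47 monomials, coefficients in `{±1, ±2, −4, 6, −10}`, degree `|T|` in `r_T` — which is
`evalT` of the table `hit4TermsV` (`sahiE4_fifteenRegion_nonneg`, identity by `simp` + `ring`).  (3) `P₄ ≥ 0` on `[0,1]^15`: its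
`2⁴·3⁶·4⁴·5 = 14 929 920` tensor-Bernstein coefficients at multidegree `(|T|)_T` are all `≥ 0` (minimum `0`) — `hit4_check`.
So order 4 of Sahi's conjecture on the whole hitting-event class (any number of coordinates) is this one certificate; the same
reduction at order `n` has `2ⁿ − 1` variables (order 5: `≈ 3.7·10¹⁶` profiles, out of enumeration range).  New mathematics, not in print.
[cite: Sahi2008, Conj. 5; LiebSahi2021, Conj. 1.1 and §3.1; Kahn2022, Conj. 5]
-/

namespace Summit.CriticalPhenomena.PercolationContinuityZ3.Theorems

namespace SahiHitting

open MeasureTheory Finset SparseBernstein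
open Literature.Probability.LatticeModels

variable {ι : Type*}

/-! ## The certificate data: the universal order-4 hitting polynomial `P₄` in the 15 Venn-region variables -/

/-- Multidegree `(|T|)_T`, regions ordered `A B C D AB AC AD BC BD CD ABC ABD ACD BCD ABCD` (list form, for the checker). [this work] -/
def hit4DegL : List ℕ := [1, 1, 1, 1, 2, 2, 2, 2, 2, 2, 3, 3, 3, 3, 4]

/-- The 47 terms (coefficient, exponent vector) of `P₄`, list form (compiled; consumed by `SparseBernstein.check`). [this work] -/
def hit4Data : List (ℤ × List ℕ) := [
  ((2 : ℤ), [0, 0, 1, 1, 0, 1, 1, 1, 1, 1, 1, 1, 1, 1, 1]), ((-2 : ℤ), [0, 0, 1, 1, 0, 1, 1, 1, 1, 2, 1, 1, 2, 2, 2]),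
  ((2 : ℤ), [0, 1, 0, 1, 1, 0, 1, 1, 1, 1, 1, 1, 1, 1, 1]), ((-2 : ℤ), [0, 1, 0, 1, 1, 0, 1, 1, 2, 1, 1, 2, 1, 2, 2]),
  ((2 : ℤ), [0, 1, 1, 0, 1, 1, 0, 1, 1, 1, 1, 1, 1, 1, 1]), ((-2 : ℤ), [0, 1, 1, 0, 1, 1, 0, 2, 1, 1, 2, 1, 1, 2, 2]),
  ((-4 : ℤ), [0, 1, 1, 1, 1, 1, 1, 1, 1, 1, 1, 1, 1, 1, 1]), ((2 : ℤ), [0, 1, 1, 1, 1, 1, 1, 1, 2, 2, 1, 2, 2, 2, 2]),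
  ((2 : ℤ), [0, 1, 1, 1, 1, 1, 1, 2, 1, 2, 2, 1, 2, 2, 2]), ((2 : ℤ), [0, 1, 1, 1, 1, 1, 1, 2, 2, 1, 2, 2, 1, 2, 2]),
  ((-2 : ℤ), [0, 1, 1, 1, 1, 1, 1, 2, 2, 2, 2, 2, 2, 3, 3]), ((2 : ℤ), [1, 0, 0, 1, 1, 1, 1, 0, 1, 1, 1, 1, 1, 1, 1]),
  ((-2 : ℤ), [1, 0, 0, 1, 1, 1, 2, 0, 1, 1, 1, 2, 2, 1, 2]), ((2 : ℤ), [1, 0, 1, 0, 1, 1, 1, 1, 0, 1, 1, 1, 1, 1, 1]),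
  ((-2 : ℤ), [1, 0, 1, 0, 1, 2, 1, 1, 0, 1, 2, 1, 2, 1, 2]), ((-4 : ℤ), [1, 0, 1, 1, 1, 1, 1, 1, 1, 1, 1, 1, 1, 1, 1]),
  ((2 : ℤ), [1, 0, 1, 1, 1, 1, 2, 1, 1, 2, 1, 2, 2, 2, 2]), ((2 : ℤ), [1, 0, 1, 1, 1, 2, 1, 1, 1, 2, 2, 1, 2, 2, 2]),
  ((2 : ℤ), [1, 0, 1, 1, 1, 2, 2, 1, 1, 1, 2, 2, 2, 1, 2]), ((-2 : ℤ), [1, 0, 1, 1, 1, 2, 2, 1, 1, 2, 2, 2, 3, 2, 3]),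
  ((2 : ℤ), [1, 1, 0, 0, 1, 1, 1, 1, 1, 0, 1, 1, 1, 1, 1]), ((-2 : ℤ), [1, 1, 0, 0, 2, 1, 1, 1, 1, 0, 2, 2, 1, 1, 2]),
  ((-4 : ℤ), [1, 1, 0, 1, 1, 1, 1, 1, 1, 1, 1, 1, 1, 1, 1]), ((2 : ℤ), [1, 1, 0, 1, 1, 1, 2, 1, 2, 1, 1, 2, 2, 2, 2]),
  ((2 : ℤ), [1, 1, 0, 1, 2, 1, 1, 1, 2, 1, 2, 2, 1, 2, 2]), ((2 : ℤ), [1, 1, 0, 1, 2, 1, 2, 1, 1, 1, 2, 2, 2, 1, 2]),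
  ((-2 : ℤ), [1, 1, 0, 1, 2, 1, 2, 1, 2, 1, 2, 3, 2, 2, 3]), ((-4 : ℤ), [1, 1, 1, 0, 1, 1, 1, 1, 1, 1, 1, 1, 1, 1, 1]),
  ((2 : ℤ), [1, 1, 1, 0, 1, 2, 1, 2, 1, 1, 2, 1, 2, 2, 2]), ((2 : ℤ), [1, 1, 1, 0, 2, 1, 1, 2, 1, 1, 2, 2, 1, 2, 2]),
  ((2 : ℤ), [1, 1, 1, 0, 2, 2, 1, 1, 1, 1, 2, 2, 2, 1, 2]), ((-2 : ℤ), [1, 1, 1, 0, 2, 2, 1, 2, 1, 1, 3, 2, 2, 2, 3]),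
  ((6 : ℤ), [1, 1, 1, 1, 1, 1, 1, 1, 1, 1, 1, 1, 1, 1, 1]), ((-2 : ℤ), [1, 1, 1, 1, 1, 1, 2, 1, 2, 2, 1, 2, 2, 2, 2]),
  ((-2 : ℤ), [1, 1, 1, 1, 1, 2, 1, 2, 1, 2, 2, 1, 2, 2, 2]), ((-1 : ℤ), [1, 1, 1, 1, 1, 2, 2, 2, 2, 1, 2, 2, 2, 2, 2]),
  ((1 : ℤ), [1, 1, 1, 1, 1, 2, 2, 2, 2, 2, 2, 2, 3, 3, 3]), ((-2 : ℤ), [1, 1, 1, 1, 2, 1, 1, 2, 2, 1, 2, 2, 1, 2, 2]),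
  ((-1 : ℤ), [1, 1, 1, 1, 2, 1, 2, 2, 1, 2, 2, 2, 2, 2, 2]), ((1 : ℤ), [1, 1, 1, 1, 2, 1, 2, 2, 2, 2, 2, 3, 2, 3, 3]),
  ((-1 : ℤ), [1, 1, 1, 1, 2, 2, 1, 1, 2, 2, 2, 2, 2, 2, 2]), ((1 : ℤ), [1, 1, 1, 1, 2, 2, 1, 2, 2, 2, 3, 2, 2, 3, 3]),
  ((-2 : ℤ), [1, 1, 1, 1, 2, 2, 2, 1, 1, 1, 2, 2, 2, 1, 2]), ((1 : ℤ), [1, 1, 1, 1, 2, 2, 2, 1, 2, 2, 2, 3, 3, 2, 3]),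
  ((1 : ℤ), [1, 1, 1, 1, 2, 2, 2, 2, 1, 2, 3, 2, 3, 2, 3]), ((1 : ℤ), [1, 1, 1, 1, 2, 2, 2, 2, 2, 1, 3, 3, 2, 2, 3]),
  ((-1 : ℤ), [1, 1, 1, 1, 2, 2, 2, 2, 2, 2, 3, 3, 3, 3, 4])]

/-- The multidegree as a function on `Fin 15`. [this work] -/
def hit4Deg : Fin 15 → ℕ := fun i => hit4DegL.getD i.1 0

/-- The term table as a function (compiled form: look-ups in the lists). [this work] -/
def hit4Terms : Fin 47 → ℤ × (Fin 15 → ℕ) := fun r =>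
  ((hit4Data.getD r.1 (0, [])).1, fun i => (hit4Data.getD r.1 (0, [])).2.getD i.1 0)

/-- The same table written with vector literals (not compiled — used for symbolic unfolding by `simp`). [this work] -/
noncomputable def hit4TermsV : Fin 47 → ℤ × (Fin 15 → ℕ) := ![
  ((2 : ℤ), ![0, 0, 1, 1, 0, 1, 1, 1, 1, 1, 1, 1, 1, 1, 1]), ((-2 : ℤ), ![0, 0, 1, 1, 0, 1, 1, 1, 1, 2, 1, 1, 2, 2, 2]),
  ((2 : ℤ), ![0, 1, 0, 1, 1, 0, 1, 1, 1, 1, 1, 1, 1, 1, 1]), ((-2 : ℤ), ![0, 1, 0, 1, 1, 0, 1, 1, 2, 1, 1, 2, 1, 2, 2]),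
  ((2 : ℤ), ![0, 1, 1, 0, 1, 1, 0, 1, 1, 1, 1, 1, 1, 1, 1]), ((-2 : ℤ), ![0, 1, 1, 0, 1, 1, 0, 2, 1, 1, 2, 1, 1, 2, 2]),
  ((-4 : ℤ), ![0, 1, 1, 1, 1, 1, 1, 1, 1, 1, 1, 1, 1, 1, 1]), ((2 : ℤ), ![0, 1, 1, 1, 1, 1, 1, 1, 2, 2, 1, 2, 2, 2, 2]),
  ((2 : ℤ), ![0, 1, 1, 1, 1, 1, 1, 2, 1, 2, 2, 1, 2, 2, 2]), ((2 : ℤ), ![0, 1, 1, 1, 1, 1, 1, 2, 2, 1, 2, 2, 1, 2, 2]),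
  ((-2 : ℤ), ![0, 1, 1, 1, 1, 1, 1, 2, 2, 2, 2, 2, 2, 3, 3]), ((2 : ℤ), ![1, 0, 0, 1, 1, 1, 1, 0, 1, 1, 1, 1, 1, 1, 1]),
  ((-2 : ℤ), ![1, 0, 0, 1, 1, 1, 2, 0, 1, 1, 1, 2, 2, 1, 2]), ((2 : ℤ), ![1, 0, 1, 0, 1, 1, 1, 1, 0, 1, 1, 1, 1, 1, 1]),
  ((-2 : ℤ), ![1, 0, 1, 0, 1, 2, 1, 1, 0, 1, 2, 1, 2, 1, 2]), ((-4 : ℤ), ![1, 0, 1, 1, 1, 1, 1, 1, 1, 1, 1, 1, 1, 1, 1]),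
  ((2 : ℤ), ![1, 0, 1, 1, 1, 1, 2, 1, 1, 2, 1, 2, 2, 2, 2]), ((2 : ℤ), ![1, 0, 1, 1, 1, 2, 1, 1, 1, 2, 2, 1, 2, 2, 2]),
  ((2 : ℤ), ![1, 0, 1, 1, 1, 2, 2, 1, 1, 1, 2, 2, 2, 1, 2]), ((-2 : ℤ), ![1, 0, 1, 1, 1, 2, 2, 1, 1, 2, 2, 2, 3, 2, 3]),
  ((2 : ℤ), ![1, 1, 0, 0, 1, 1, 1, 1, 1, 0, 1, 1, 1, 1, 1]), ((-2 : ℤ), ![1, 1, 0, 0, 2, 1, 1, 1, 1, 0, 2, 2, 1, 1, 2]),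
  ((-4 : ℤ), ![1, 1, 0, 1, 1, 1, 1, 1, 1, 1, 1, 1, 1, 1, 1]), ((2 : ℤ), ![1, 1, 0, 1, 1, 1, 2, 1, 2, 1, 1, 2, 2, 2, 2]),
  ((2 : ℤ), ![1, 1, 0, 1, 2, 1, 1, 1, 2, 1, 2, 2, 1, 2, 2]), ((2 : ℤ), ![1, 1, 0, 1, 2, 1, 2, 1, 1, 1, 2, 2, 2, 1, 2]),
  ((-2 : ℤ), ![1, 1, 0, 1, 2, 1, 2, 1, 2, 1, 2, 3, 2, 2, 3]), ((-4 : ℤ), ![1, 1, 1, 0, 1, 1, 1, 1, 1, 1, 1, 1, 1, 1, 1]),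
  ((2 : ℤ), ![1, 1, 1, 0, 1, 2, 1, 2, 1, 1, 2, 1, 2, 2, 2]), ((2 : ℤ), ![1, 1, 1, 0, 2, 1, 1, 2, 1, 1, 2, 2, 1, 2, 2]),
  ((2 : ℤ), ![1, 1, 1, 0, 2, 2, 1, 1, 1, 1, 2, 2, 2, 1, 2]), ((-2 : ℤ), ![1, 1, 1, 0, 2, 2, 1, 2, 1, 1, 3, 2, 2, 2, 3]),
  ((6 : ℤ), ![1, 1, 1, 1, 1, 1, 1, 1, 1, 1, 1, 1, 1, 1, 1]), ((-2 : ℤ), ![1, 1, 1, 1, 1, 1, 2, 1, 2, 2, 1, 2, 2, 2, 2]),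
  ((-2 : ℤ), ![1, 1, 1, 1, 1, 2, 1, 2, 1, 2, 2, 1, 2, 2, 2]), ((-1 : ℤ), ![1, 1, 1, 1, 1, 2, 2, 2, 2, 1, 2, 2, 2, 2, 2]),
  ((1 : ℤ), ![1, 1, 1, 1, 1, 2, 2, 2, 2, 2, 2, 2, 3, 3, 3]), ((-2 : ℤ), ![1, 1, 1, 1, 2, 1, 1, 2, 2, 1, 2, 2, 1, 2, 2]),
  ((-1 : ℤ), ![1, 1, 1, 1, 2, 1, 2, 2, 1, 2, 2, 2, 2, 2, 2]), ((1 : ℤ), ![1, 1, 1, 1, 2, 1, 2, 2, 2, 2, 2, 3, 2, 3, 3]),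
  ((-1 : ℤ), ![1, 1, 1, 1, 2, 2, 1, 1, 2, 2, 2, 2, 2, 2, 2]), ((1 : ℤ), ![1, 1, 1, 1, 2, 2, 1, 2, 2, 2, 3, 2, 2, 3, 3]),
  ((-2 : ℤ), ![1, 1, 1, 1, 2, 2, 2, 1, 1, 1, 2, 2, 2, 1, 2]), ((1 : ℤ), ![1, 1, 1, 1, 2, 2, 2, 1, 2, 2, 2, 3, 3, 2, 3]),
  ((1 : ℤ), ![1, 1, 1, 1, 2, 2, 2, 2, 1, 2, 3, 2, 3, 2, 3]), ((1 : ℤ), ![1, 1, 1, 1, 2, 2, 2, 2, 2, 1, 3, 3, 2, 2, 3]),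
  ((-1 : ℤ), ![1, 1, 1, 1, 2, 2, 2, 2, 2, 2, 3, 3, 3, 3, 4])]

/-- The two tables agree (kernel computation). [this work] -/
theorem hit4Terms_eq : hit4TermsV = hit4Terms := by
  decide +kernel

/-- **The certificate**: all `14 929 920` tensor-Bernstein coefficients of `P₄` at multidegree `(|T|)_T` are `≥ 0`
(depth-first enumeration with running products, `SparseBernstein.check`). [this work] -/
theorem hit4_check : check hit4Terms hit4Deg = true := by
  native_decide

/-- The exponents are bounded by the multidegree. [this work] -/
theorem hit4_deg : ∀ r i, (hit4Terms r).2 i ≤ hit4Deg i := by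
  decide +kernel

/-- **`P₄ ≥ 0` on the unit cube**, in the form `0 ≤ evalT hit4TermsV x` (from the certificate). [this work] -/
theorem hit4_evalT_nonneg (rA rB rC rD rAB rAC rAD rBC rBD rCD rABC rABD rACD rBCD rABCD : ℝ)
    (hrA0 : 0 ≤ rA) (hrA1 : rA ≤ 1) (hrB0 : 0 ≤ rB) (hrB1 : rB ≤ 1) (hrC0 : 0 ≤ rC) (hrC1 : rC ≤ 1) (hrD0 : 0 ≤ rD) (hrD1 : rD ≤ 1) (hrAB0 : 0 ≤ rAB) (hrAB1 : rAB ≤ 1) (hrAC0 : 0 ≤ rAC) (hrAC1 : rAC ≤ 1) (hrAD0 : 0 ≤ rAD) (hrAD1 : rAD ≤ 1) (hrBC0 : 0 ≤ rBC) (hrBC1 : rBC ≤ 1) (hrBD0 : 0 ≤ rBD) (hrBD1 : rBD ≤ 1) (hrCD0 : 0 ≤ rCD) (hrCD1 : rCD ≤ 1) (hrABC0 : 0 ≤ rABC) (hrABC1 : rABC ≤ 1) (hrABD0 : 0 ≤ rABD) (hrABD1 : rABD ≤ 1) (hrACD0 : 0 ≤ rACD) (hrACD1 : rACD ≤ 1)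 (hrBCD0 : 0 ≤ rBCD) (hrBCD1 : rBCD ≤ 1) (hrABCD0 : 0 ≤ rABCD) (hrABCD1 : rABCD ≤ 1) :
    0 ≤ evalT hit4TermsV ![rA, rB, rC, rD, rAB, rAC, rAD, rBC, rBD, rCD, rABC, rABD, rACD, rBCD, rABCD] := by
  have hx : ∀ i : Fin 15, 0 ≤ (![rA, rB, rC, rD, rAB, rAC, rAD, rBC, rBD, rCD, rABC, rABD, rACD, rBCD, rABCD] : Fin 15 → ℝ) i ∧ (![rA, rB, rC, rD, rAB, rAC, rAD, rBC, rBD, rCD, rABC, rABD, rACD, rBCD, rABCD] : Fin 15 → ℝ) i ≤ 1 := by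
    simp only [Fin.forall_fin_succ, IsEmpty.forall_iff, Matrix.cons_val_zero, Matrix.cons_val_succ, and_true]
    exact ⟨⟨hrA0, hrA1⟩, ⟨hrB0, hrB1⟩, ⟨hrC0, hrC1⟩, ⟨hrD0, hrD1⟩, ⟨hrAB0, hrAB1⟩, ⟨hrAC0, hrAC1⟩, ⟨hrAD0, hrAD1⟩, ⟨hrBC0, hrBC1⟩, ⟨hrBD0, hrBD1⟩, ⟨hrCD0, hrCD1⟩, ⟨hrABC0, hrABC1⟩, ⟨hrABD0, hrABD1⟩, ⟨hrACD0, hrACD1⟩, ⟨hrBCD0, hrBCD1⟩, ⟨hrABCD0, hrABCD1⟩⟩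
  exact evalT_nonneg_of_bcoef hit4TermsV hit4Deg (by rw [hit4Terms_eq]; exact hit4_deg)
    (by rw [hit4Terms_eq]; exact check_sound _ _ hit4_check) hx

/-! ## The fifteen-region form of `E₄` of four hitting events -/

set_option maxHeartbeats 4000000 in
/-- **The fifteen-region form is nonnegative**: with the miss-probabilities `Q_𝒮` written as products of the region variables
`r_T` (`T ∩ 𝒮 ≠ ∅`), the complementation expression `E₄(M) − 2ΣE₃(M) + 2ΣE₂(M)` (= `E₄` of the hitting events) equals
`P₄(r) = evalT hit4TermsV r ≥ 0`. [this work] -/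
theorem sahiE4_fifteenRegion_nonneg {QA QB QC QD QAB QAC QAD QBC QBD QCD QABC QABD QACD QBCD QABCD : ℝ}
    {rA rB rC rD rAB rAC rAD rBC rBD rCD rABC rABD rACD rBCD rABCD : ℝ}
    (hQA : QA = rA * rAB * rAC * rAD * rABC * rABD * rACD * rABCD)
    (hQB : QB = rB * rAB * rBC * rBD * rABC * rABD * rBCD * rABCD)
    (hQC : QC = rC * rAC * rBC * rCD * rABC * rACD * rBCD * rABCD)
    (hQD : QD = rD * rAD * rBD * rCD * rABD * rACD * rBCD * rABCD)
    (hQAB : QAB = rA * rB * rAB * rAC * rAD * rBC * rBD * rABC * rABD * rACD * rBCD * rABCD)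
    (hQAC : QAC = rA * rC * rAB * rAC * rAD * rBC * rCD * rABC * rABD * rACD * rBCD * rABCD)
    (hQAD : QAD = rA * rD * rAB * rAC * rAD * rBD * rCD * rABC * rABD * rACD * rBCD * rABCD)
    (hQBC : QBC = rB * rC * rAB * rAC * rBC * rBD * rCD * rABC * rABD * rACD * rBCD * rABCD)
    (hQBD : QBD = rB * rD * rAB * rAD * rBC * rBD * rCD * rABC * rABD * rACD * rBCD * rABCD)
    (hQCD : QCD = rC * rD * rAC * rAD * rBC * rBD * rCD * rABC * rABD * rACD * rBCD * rABCD)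
    (hQABC : QABC = rA * rB * rC * rAB * rAC * rAD * rBC * rBD * rCD * rABC * rABD * rACD * rBCD * rABCD)
    (hQABD : QABD = rA * rB * rD * rAB * rAC * rAD * rBC * rBD * rCD * rABC * rABD * rACD * rBCD * rABCD)
    (hQACD : QACD = rA * rC * rD * rAB * rAC * rAD * rBC * rBD * rCD * rABC * rABD * rACD * rBCD * rABCD)
    (hQBCD : QBCD = rB * rC * rD * rAB * rAC * rAD * rBC * rBD * rCD * rABC * rABD * rACD * rBCD * rABCD)
    (hQABCD : QABCD = rA * rB * rC * rD * rAB * rAC * rAD * rBC * rBD * rCD * rABC * rABD * rACD * rBCD * rABCD)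
    (hrA0 : 0 ≤ rA) (hrA1 : rA ≤ 1) (hrB0 : 0 ≤ rB) (hrB1 : rB ≤ 1) (hrC0 : 0 ≤ rC) (hrC1 : rC ≤ 1) (hrD0 : 0 ≤ rD) (hrD1 : rD ≤ 1) (hrAB0 : 0 ≤ rAB) (hrAB1 : rAB ≤ 1) (hrAC0 : 0 ≤ rAC) (hrAC1 : rAC ≤ 1) (hrAD0 : 0 ≤ rAD) (hrAD1 : rAD ≤ 1) (hrBC0 : 0 ≤ rBC) (hrBC1 : rBC ≤ 1) (hrBD0 : 0 ≤ rBD) (hrBD1 : rBD ≤ 1) (hrCD0 : 0 ≤ rCD) (hrCD1 : rCD ≤ 1) (hrABC0 : 0 ≤ rABC) (hrABC1 : rABC ≤ 1) (hrABD0 : 0 ≤ rABD) (hrABD1 : rABD ≤ 1) (hrACD0 : 0 ≤ rACD) (hrACD1 : rACD ≤ 1) (hrBCD0 : 0 ≤ rBCD) (hrBCD1 : rBCD ≤ 1) (hrABCD0 : 0 ≤ rABCD) (hrABCD1 : rABCD ≤ 1) :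
    0 ≤ 6 * QABCD - 2 * (QA * QBCD + QB * QACD + QC * QABD + QD * QABC) + (QA * QB * QCD + QA * QC * QBD + QA * QD * QBC + QB * QC * QAD + QB * QD * QAC + QC * QD * QAB) - (QAB * QCD + QAC * QBD + QAD * QBC) - QA * QB * QC * QD - 2 * (2 * QABC + QA * QB * QC - (QA * QBC + QB * QAC + QC * QAB) + (2 * QABD + QA * QB * QD - (QA * QBD + QB * QAD + QD * QAB)) + (2 * QACD + QA * QC * QD - (QA * QCD + QC * QAD + QD * QAC)) + (2 * QBCD + QB * QC * QD - (QB * QCD + QC * QBD + QD * QBC))) + 2 * (QAB - QA * QB + (QAC - QA * QC) + (QAD - QA * QD) + (QBC - QB * QC) + (QBD - QB * QD) + (QCD - QC * QD)) := by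
  subst hQA hQB hQC hQD hQAB hQAC hQAD hQBC hQBD hQCD hQABC hQABD hQACD hQBCD hQABCD
  have hP := hit4_evalT_nonneg rA rB rC rD rAB rAC rAD rBC rBD rCD rABC rABD rACD rBCD rABCD hrA0 hrA1 hrB0 hrB1 hrC0 hrC1 hrD0 hrD1 hrAB0 hrAB1 hrAC0 hrAC1 hrAD0 hrAD1 hrBC0 hrBC1 hrBD0 hrBD1 hrCD0 hrCD1 hrABC0 hrABC1 hrABD0 hrABD1 hrACD0 hrACD1 hrBCD0 hrBCD1 hrABCD0 hrABCD1
  have e : evalT hit4TermsV ![rA, rB, rC, rD, rAB, rAC, rAD, rBC, rBD, rCD, rABC, rABD, rACD, rBCD, rABCD] = 6 * (rA * rB * rC * rD * rAB * rAC * rAD * rBC * rBD * rCD * rABC * rABD * rACD * rBCD * rABCD) - 2 * ((rA * rAB * rAC * rAD * rABC * rABD * rACD * rABCD) * (rB * rC * rD * rAB * rAC * rAD * rBC * rBD * rCD * rABC * rABD * rACD * rBCD * rABCD) + (rB * rAB * rBC * rBD * rABC * rABD * rBCD * rABCD) * (rA * rC * rD * rAB * rAC * rAD * rBC * rBD * rCD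 * rABC * rABD * rACD * rBCD * rABCD) + (rC * rAC * rBC * rCD * rABC * rACD * rBCD * rABCD) * (rA * rB * rD * rAB * rAC * rAD * rBC * rBD * rCD * rABC * rABD * rACD * rBCD * rABCD) + (rD * rAD * rBD * rCD * rABD * rACD * rBCD * rABCD) * (rA * rB * rC * rAB * rAC * rAD * rBC * rBD * rCD * rABC * rABD * rACD * rBCD * rABCD)) + ((rA * rAB * rAC * rAD * rABC * rABD * rACD * rABCD) * (rB * rAB * rBC * rBD * rABC * rABD * rBCD * rABCD) * (rC * rD * rAC * rAD * rBC * rBD * rCD * rABC * rABD * rACD * rBCD * rABCD) + (rA * rAB * rAC * rAD * rABC * rABD * rACD * rABCD) * (rC * rAC * rBC * rCD * rABC * rACD * rBCD * rABCD) * (rB * rD * rAB * rAD * rBC * rBD * rCD * rABC * rABD * rACD * rBCD * rABCD) + (rA * rAB * rAC * rAD * rABC * rABD * rACD * rABCD) * (rD * rAD * rBD * rCD * rABD * rACD * rBCD * rABCD) * (rB * rC * rAB * rAC * rBC * rBD * rCD * rABC * rABD * rACD * rBCD * rABCD) + (rB * rAB * rBC * rBD * rABC * rABD * rBCD * rABCD)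 * (rC * rAC * rBC * rCD * rABC * rACD * rBCD * rABCD) * (rA * rD * rAB * rAC * rAD * rBD * rCD * rABC * rABD * rACD * rBCD * rABCD) + (rB * rAB * rBC * rBD * rABC * rABD * rBCD * rABCD) * (rD * rAD * rBD * rCD * rABD * rACD * rBCD * rABCD) * (rA * rC * rAB * rAC * rAD * rBC * rCD * rABC * rABD * rACD * rBCD * rABCD) + (rC * rAC * rBC * rCD * rABC * rACD * rBCD * rABCD) * (rD * rAD * rBD * rCD * rABD * rACD * rBCD * rABCD) * (rA * rB * rAB * rAC * rAD * rBC * rBD * rABC * rABD * rACD * rBCD * rABCD)) - ((rA * rB * rAB * rAC * rAD * rBC * rBD * rABC * rABD * rACD * rBCD * rABCD) * (rC * rD * rAC * rAD * rBC * rBD * rCD * rABC * rABD * rACD * rBCD * rABCD) + (rA * rC * rAB * rAC * rAD * rBC * rCD * rABC * rABD * rACD * rBCD * rABCD) * (rB * rD * rAB * rAD * rBC * rBD * rCD * rABC * rABD * rACD * rBCD * rABCD) + (rA * rD * rAB * rAC * rAD * rBD * rCD * rABC * rABD * rACD * rBCD * rABCD) * (rB * rC * rAB * rAC * rBC * rBD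 * rCD * rABC * rABD * rACD * rBCD * rABCD)) - (rA * rAB * rAC * rAD * rABC * rABD * rACD * rABCD) * (rB * rAB * rBC * rBD * rABC * rABD * rBCD * rABCD) * (rC * rAC * rBC * rCD * rABC * rACD * rBCD * rABCD) * (rD * rAD * rBD * rCD * rABD * rACD * rBCD * rABCD) - 2 * (2 * (rA * rB * rC * rAB * rAC * rAD * rBC * rBD * rCD * rABC * rABD * rACD * rBCD * rABCD) + (rA * rAB * rAC * rAD * rABC * rABD * rACD * rABCD) * (rB * rAB * rBC * rBD * rABC * rABD * rBCD * rABCD) * (rC * rAC * rBC * rCD * rABC * rACD * rBCD * rABCD) - ((rA * rAB * rAC * rAD * rABC * rABD * rACD * rABCD) * (rB * rC * rAB * rAC * rBC * rBD * rCD * rABC * rABD * rACD * rBCD * rABCD) + (rB * rAB * rBC * rBD * rABC * rABD * rBCD * rABCD) * (rA * rC * rAB * rAC * rAD * rBC * rCD * rABC * rABD * rACD * rBCD * rABCD) + (rC * rAC * rBC * rCD * rABC * rACD * rBCD * rABCD) * (rA * rB * rAB * rAC * rAD * rBC * rBD * rABC * rABD * rACD * rBCD * rABCD)) + (2 * (rA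 * rB * rD * rAB * rAC * rAD * rBC * rBD * rCD * rABC * rABD * rACD * rBCD * rABCD) + (rA * rAB * rAC * rAD * rABC * rABD * rACD * rABCD) * (rB * rAB * rBC * rBD * rABC * rABD * rBCD * rABCD) * (rD * rAD * rBD * rCD * rABD * rACD * rBCD * rABCD) - ((rA * rAB * rAC * rAD * rABC * rABD * rACD * rABCD) * (rB * rD * rAB * rAD * rBC * rBD * rCD * rABC * rABD * rACD * rBCD * rABCD) + (rB * rAB * rBC * rBD * rABC * rABD * rBCD * rABCD) * (rA * rD * rAB * rAC * rAD * rBD * rCD * rABC * rABD * rACD * rBCD * rABCD) + (rD * rAD * rBD * rCD * rABD * rACD * rBCD * rABCD) * (rA * rB * rAB * rAC * rAD * rBC * rBD * rABC * rABD * rACD * rBCD * rABCD))) + (2 * (rA * rC * rD * rAB * rAC * rAD * rBC * rBD * rCD * rABC * rABD * rACD * rBCD * rABCD) + (rA * rAB * rAC * rAD * rABC * rABD * rACD * rABCD) * (rC * rAC * rBC * rCD * rABC * rACD * rBCD * rABCD) * (rD * rAD * rBD * rCD * rABD * rACD * rBCD * rABCD) - ((rA * rAB * rAC * rAD * rABC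 * rABD * rACD * rABCD) * (rC * rD * rAC * rAD * rBC * rBD * rCD * rABC * rABD * rACD * rBCD * rABCD) + (rC * rAC * rBC * rCD * rABC * rACD * rBCD * rABCD) * (rA * rD * rAB * rAC * rAD * rBD * rCD * rABC * rABD * rACD * rBCD * rABCD) + (rD * rAD * rBD * rCD * rABD * rACD * rBCD * rABCD) * (rA * rC * rAB * rAC * rAD * rBC * rCD * rABC * rABD * rACD * rBCD * rABCD))) + (2 * (rB * rC * rD * rAB * rAC * rAD * rBC * rBD * rCD * rABC * rABD * rACD * rBCD * rABCD) + (rB * rAB * rBC * rBD * rABC * rABD * rBCD * rABCD) * (rC * rAC * rBC * rCD * rABC * rACD * rBCD * rABCD) * (rD * rAD * rBD * rCD * rABD * rACD * rBCD * rABCD) - ((rB * rAB * rBC * rBD * rABC * rABD * rBCD * rABCD) * (rC * rD * rAC * rAD * rBC * rBD * rCD * rABC * rABD * rACD * rBCD * rABCD) + (rC * rAC * rBC * rCD * rABC * rACD * rBCD * rABCD) * (rB * rD * rAB * rAD * rBC * rBD * rCD * rABC * rABD * rACD * rBCD * rABCD) + (rD * rAD * rBD * rCD * rABD * rACD * rBCD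 * rABCD) * (rB * rC * rAB * rAC * rBC * rBD * rCD * rABC * rABD * rACD * rBCD * rABCD)))) + 2 * ((rA * rB * rAB * rAC * rAD * rBC * rBD * rABC * rABD * rACD * rBCD * rABCD) - (rA * rAB * rAC * rAD * rABC * rABD * rACD * rABCD) * (rB * rAB * rBC * rBD * rABC * rABD * rBCD * rABCD) + ((rA * rC * rAB * rAC * rAD * rBC * rCD * rABC * rABD * rACD * rBCD * rABCD) - (rA * rAB * rAC * rAD * rABC * rABD * rACD * rABCD) * (rC * rAC * rBC * rCD * rABC * rACD * rBCD * rABCD)) + ((rA * rD * rAB * rAC * rAD * rBD * rCD * rABC * rABD * rACD * rBCD * rABCD) - (rA * rAB * rAC * rAD * rABC * rABD * rACD * rABCD) * (rD * rAD * rBD * rCD * rABD * rACD * rBCD * rABCD)) + ((rB * rC * rAB * rAC * rBC * rBD * rCD * rABC * rABD * rACD * rBCD * rABCD) - (rB * rAB * rBC * rBD * rABC * rABD * rBCD * rABCD) * (rC * rAC * rBC * rCD * rABC * rACD * rBCD * rABCD)) + ((rB * rD * rAB * rAD * rBC * rBD * rCD * rABC * rABD * rACD * rBCD * rABCD) - (rB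 * rAB * rBC * rBD * rABC * rABD * rBCD * rABCD) * (rD * rAD * rBD * rCD * rABD * rACD * rBCD * rABCD)) + ((rC * rD * rAC * rAD * rBC * rBD * rCD * rABC * rABD * rACD * rBCD * rABCD) - (rC * rAC * rBC * rCD * rABC * rACD * rBCD * rABCD) * (rD * rAD * rBD * rCD * rABD * rACD * rBCD * rABCD))) := by
    simp only [evalT, hit4TermsV, Fin.sum_univ_succ, Fin.sum_univ_zero, Fin.prod_univ_succ, Fin.prod_univ_zero,
      Matrix.cons_val_zero, Matrix.cons_val_succ, pow_zero, pow_one, mul_one, add_zero, Int.cast_ofNat, Int.cast_neg,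
      Int.cast_one]
    ring
  linarith [hP, e]

/-! ## The theorem -/

set_option maxHeartbeats 4000000 in
/-- **Sahi's `C₄` for four hitting events** (Lieb–Sahi `E₄ ≥ 0` at order 4 for disjunctions of coordinates): for every index
type `ι`, every `p : ι → [0,1]` and all finite `A, B, C, D ⊆ ι`, `0 ≤ E₄(H_A, H_B, H_C, H_D)` for the hitting events
`H_S = {ω | ∃ i ∈ S, i ∈ ω}` of `prodBernoulli p`. [this work; cite: Sahi2008, Conj. 5; LiebSahi2021, Conj. 1.1] -/
theorem prodBernoulli_sahiE4_hit_nonneg (p : ι → unitInterval) (A B C D : Finset ι) :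
    0 ≤ sahiE4 (prodBernoulli p)
      {ω : Set ι | ∃ i ∈ A, i ∈ ω} {ω : Set ι | ∃ i ∈ B, i ∈ ω} {ω : Set ι | ∃ i ∈ C, i ∈ ω} {ω : Set ι | ∃ i ∈ D, i ∈ ω} := by
  classical
  set q : ι → ℝ := fun i => 1 - (p i : ℝ) with hq
  have hq0 : ∀ i, 0 ≤ q i := fun i => sub_nonneg.2 (p i).2.2
  have hq1 : ∀ i, q i ≤ 1 := fun i => sub_le_self _ (p i).2.1
  set U : Finset ι := A ∪ B ∪ C ∪ D with hU
  set gA : Finset ι := ((A \ B) \ C) \ D with hgA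
  set gB : Finset ι := ((B \ A) \ C) \ D with hgB
  set gC : Finset ι := ((C \ A) \ B) \ D with hgC
  set gD : Finset ι := ((D \ A) \ B) \ C with hgD
  set gAB : Finset ι := ((A ∩ B) \ C) \ D with hgAB
  set gAC : Finset ι := ((A ∩ C) \ B) \ D with hgAC
  set gAD : Finset ι := ((A ∩ D) \ B) \ C with hgAD
  set gBC : Finset ι := ((B ∩ C) \ A) \ D with hgBC
  set gBD : Finset ι := ((B ∩ D) \ A) \ C with hgBD
  set gCD : Finset ι := ((C ∩ D) \ A) \ B with hgCD
  set gABC : Finset ι := (A ∩ B ∩ C) \ D with hgABC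
  set gABD : Finset ι := (A ∩ B ∩ D) \ C with hgABD
  set gACD : Finset ι := (A ∩ C ∩ D) \ B with hgACD
  set gBCD : Finset ι := (B ∩ C ∩ D) \ A with hgBCD
  set gABCD : Finset ι := A ∩ B ∩ C ∩ D with hgABCD
  have P0 : ∀ S : Finset ι, 0 ≤ ∏ i ∈ S, q i := fun S => Finset.prod_nonneg fun i _ => hq0 i
  have P1 : ∀ S : Finset ι, ∏ i ∈ S, q i ≤ 1 := fun S =>
    Finset.prod_le_one (fun i _ => hq0 i) fun i _ => hq1 i
  have eU : ∀ {S : Finset ι}, S ⊆ U → ∏ i ∈ S, q i = ∏ i ∈ U, (if i ∈ S then q i else 1) :=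
    fun h => prod_eq_prod_ite h q
  have sA : A ⊆ U := by intro i hi; simp only [hU, Finset.mem_union] at hi ⊢; tauto
  have sB : B ⊆ U := by intro i hi; simp only [hU, Finset.mem_union] at hi ⊢; tauto
  have sC : C ⊆ U := by intro i hi; simp only [hU, Finset.mem_union] at hi ⊢; tauto
  have sD : D ⊆ U := by intro i hi; simp only [hU, Finset.mem_union] at hi ⊢; tauto
  have sAB : A ∪ B ⊆ U := by intro i hi; simp only [hU, Finset.mem_union] at hi ⊢; tauto
  have sAC : A ∪ C ⊆ U := by intro i hi; simp only [hU, Finset.mem_union] at hi ⊢; tauto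
  have sAD : A ∪ D ⊆ U := by intro i hi; simp only [hU, Finset.mem_union] at hi ⊢; tauto
  have sBC : B ∪ C ⊆ U := by intro i hi; simp only [hU, Finset.mem_union] at hi ⊢; tauto
  have sBD : B ∪ D ⊆ U := by intro i hi; simp only [hU, Finset.mem_union] at hi ⊢; tauto
  have sCD : C ∪ D ⊆ U := by intro i hi; simp only [hU, Finset.mem_union] at hi ⊢; tauto
  have sABC : A ∪ B ∪ C ⊆ U := by intro i hi; simp only [hU, Finset.mem_union] at hi ⊢; tauto
  have sABD : A ∪ B ∪ D ⊆ U := by intro i hi; simp only [hU, Finset.mem_union] at hi ⊢; tauto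
  have sACD : A ∪ C ∪ D ⊆ U := by intro i hi; simp only [hU, Finset.mem_union] at hi ⊢; tauto
  have sBCD : B ∪ C ∪ D ⊆ U := by intro i hi; simp only [hU, Finset.mem_union] at hi ⊢; tauto
  have sABCD : A ∪ B ∪ C ∪ D ⊆ U := by intro i hi; simp only [hU, Finset.mem_union] at hi ⊢; tauto
  have regions : ∀ i : ι,
      (i ∈ gA ↔ i ∈ A ∧ i ∉ B ∧ i ∉ C ∧ i ∉ D) ∧
      (i ∈ gB ↔ i ∈ B ∧ i ∉ A ∧ i ∉ C ∧ i ∉ D) ∧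
      (i ∈ gC ↔ i ∈ C ∧ i ∉ A ∧ i ∉ B ∧ i ∉ D) ∧
      (i ∈ gD ↔ i ∈ D ∧ i ∉ A ∧ i ∉ B ∧ i ∉ C) ∧
      (i ∈ gAB ↔ i ∈ A ∧ i ∈ B ∧ i ∉ C ∧ i ∉ D) ∧
      (i ∈ gAC ↔ i ∈ A ∧ i ∈ C ∧ i ∉ B ∧ i ∉ D) ∧
      (i ∈ gAD ↔ i ∈ A ∧ i ∈ D ∧ i ∉ B ∧ i ∉ C) ∧
      (i ∈ gBC ↔ i ∈ B ∧ i ∈ C ∧ i ∉ A ∧ i ∉ D) ∧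
      (i ∈ gBD ↔ i ∈ B ∧ i ∈ D ∧ i ∉ A ∧ i ∉ C) ∧
      (i ∈ gCD ↔ i ∈ C ∧ i ∈ D ∧ i ∉ A ∧ i ∉ B) ∧
      (i ∈ gABC ↔ i ∈ A ∧ i ∈ B ∧ i ∈ C ∧ i ∉ D) ∧
      (i ∈ gABD ↔ i ∈ A ∧ i ∈ B ∧ i ∈ D ∧ i ∉ C) ∧
      (i ∈ gACD ↔ i ∈ A ∧ i ∈ C ∧ i ∈ D ∧ i ∉ B) ∧
      (i ∈ gBCD ↔ i ∈ B ∧ i ∈ C ∧ i ∈ D ∧ i ∉ A) ∧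
      (i ∈ gABCD ↔ i ∈ A ∧ i ∈ B ∧ i ∈ C ∧ i ∈ D) := by
    intro i
    simp only [hgA, hgB, hgC, hgD, hgAB, hgAC, hgAD, hgBC, hgBD, hgCD, hgABC, hgABD, hgACD, hgBCD, hgABCD, Finset.mem_sdiff, Finset.mem_inter]
    tauto
  have sgA : gA ⊆ U := fun i hi =>
    sA (((regions i).1).1 hi).1
  have sgB : gB ⊆ U := fun i hi =>
    sB (((regions i).2.1).1 hi).1
  have sgC : gC ⊆ U := fun i hi =>
    sC (((regions i).2.2.1).1 hi).1
  have sgD : gD ⊆ U := fun i hi =>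
    sD (((regions i).2.2.2.1).1 hi).1
  have sgAB : gAB ⊆ U := fun i hi =>
    sA (((regions i).2.2.2.2.1).1 hi).1
  have sgAC : gAC ⊆ U := fun i hi =>
    sA (((regions i).2.2.2.2.2.1).1 hi).1
  have sgAD : gAD ⊆ U := fun i hi =>
    sA (((regions i).2.2.2.2.2.2.1).1 hi).1
  have sgBC : gBC ⊆ U := fun i hi =>
    sB (((regions i).2.2.2.2.2.2.2.1).1 hi).1
  have sgBD : gBD ⊆ U := fun i hi =>
    sB (((regions i).2.2.2.2.2.2.2.2.1).1 hi).1
  have sgCD : gCD ⊆ U := fun i hi =>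
    sC (((regions i).2.2.2.2.2.2.2.2.2.1).1 hi).1
  have sgABC : gABC ⊆ U := fun i hi =>
    sA (((regions i).2.2.2.2.2.2.2.2.2.2.1).1 hi).1
  have sgABD : gABD ⊆ U := fun i hi =>
    sA (((regions i).2.2.2.2.2.2.2.2.2.2.2.1).1 hi).1
  have sgACD : gACD ⊆ U := fun i hi =>
    sA (((regions i).2.2.2.2.2.2.2.2.2.2.2.2.1).1 hi).1
  have sgBCD : gBCD ⊆ U := fun i hi =>
    sB (((regions i).2.2.2.2.2.2.2.2.2.2.2.2.2.1).1 hi).1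
  have sgABCD : gABCD ⊆ U := fun i hi =>
    sA (((regions i).2.2.2.2.2.2.2.2.2.2.2.2.2.2).1 hi).1
  have fA : ∏ i ∈ A, q i = (∏ i ∈ gA, q i) * (∏ i ∈ gAB, q i) * (∏ i ∈ gAC, q i) * (∏ i ∈ gAD, q i) * (∏ i ∈ gABC, q i) * (∏ i ∈ gABD, q i) * (∏ i ∈ gACD, q i) * (∏ i ∈ gABCD, q i) := by
    rw [eU sA, eU sgA, eU sgAB, eU sgAC, eU sgAD, eU sgABC, eU sgABD, eU sgACD, eU sgABCD, ← Finset.prod_mul_distrib, ← Finset.prod_mul_distrib, ← Finset.prod_mul_distrib, ← Finset.prod_mul_distrib, ← Finset.prod_mul_distrib, ← Finset.prod_mul_distrib, ← Finset.prod_mul_distrib]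
    refine Finset.prod_congr rfl fun i _ => ?_
    obtain ⟨hA, -, -, -, hAB, hAC, hAD, -, -, -, hABC, hABD, hACD, -, hABCD⟩ := regions i
    by_cases xA : i ∈ A <;> by_cases xB : i ∈ B <;> by_cases xC : i ∈ C <;> by_cases xD : i ∈ D <;>
      simp [hA, hAB, hAC, hAD, hABC, hABD, hACD, hABCD, xA, xB, xC, xD]
  have fB : ∏ i ∈ B, q i = (∏ i ∈ gB, q i) * (∏ i ∈ gAB, q i) * (∏ i ∈ gBC, q i) * (∏ i ∈ gBD, q i) * (∏ i ∈ gABC, q i) * (∏ i ∈ gABD, q i) * (∏ i ∈ gBCD, q i) * (∏ i ∈ gABCD, q i) := by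
    rw [eU sB, eU sgB, eU sgAB, eU sgBC, eU sgBD, eU sgABC, eU sgABD, eU sgBCD, eU sgABCD, ← Finset.prod_mul_distrib, ← Finset.prod_mul_distrib, ← Finset.prod_mul_distrib, ← Finset.prod_mul_distrib, ← Finset.prod_mul_distrib, ← Finset.prod_mul_distrib, ← Finset.prod_mul_distrib]
    refine Finset.prod_congr rfl fun i _ => ?_
    obtain ⟨-, hB, -, -, hAB, -, -, hBC, hBD, -, hABC, hABD, -, hBCD, hABCD⟩ := regions i
    by_cases xA : i ∈ A <;> by_cases xB : i ∈ B <;> by_cases xC : i ∈ C <;> by_cases xD : i ∈ D <;>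
      simp [hB, hAB, hBC, hBD, hABC, hABD, hBCD, hABCD, xA, xB, xC, xD]
  have fC : ∏ i ∈ C, q i = (∏ i ∈ gC, q i) * (∏ i ∈ gAC, q i) * (∏ i ∈ gBC, q i) * (∏ i ∈ gCD, q i) * (∏ i ∈ gABC, q i) * (∏ i ∈ gACD, q i) * (∏ i ∈ gBCD, q i) * (∏ i ∈ gABCD, q i) := by
    rw [eU sC, eU sgC, eU sgAC, eU sgBC, eU sgCD, eU sgABC, eU sgACD, eU sgBCD, eU sgABCD, ← Finset.prod_mul_distrib, ← Finset.prod_mul_distrib, ← Finset.prod_mul_distrib, ← Finset.prod_mul_distrib, ← Finset.prod_mul_distrib, ← Finset.prod_mul_distrib, ← Finset.prod_mul_distrib]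
    refine Finset.prod_congr rfl fun i _ => ?_
    obtain ⟨-, -, hC, -, -, hAC, -, hBC, -, hCD, hABC, -, hACD, hBCD, hABCD⟩ := regions i
    by_cases xA : i ∈ A <;> by_cases xB : i ∈ B <;> by_cases xC : i ∈ C <;> by_cases xD : i ∈ D <;>
      simp [hC, hAC, hBC, hCD, hABC, hACD, hBCD, hABCD, xA, xB, xC, xD]
  have fD : ∏ i ∈ D, q i = (∏ i ∈ gD, q i) * (∏ i ∈ gAD, q i) * (∏ i ∈ gBD, q i) * (∏ i ∈ gCD, q i) * (∏ i ∈ gABD, q i) * (∏ i ∈ gACD, q i) * (∏ i ∈ gBCD, q i) * (∏ i ∈ gABCD, q i) := by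
    rw [eU sD, eU sgD, eU sgAD, eU sgBD, eU sgCD, eU sgABD, eU sgACD, eU sgBCD, eU sgABCD, ← Finset.prod_mul_distrib, ← Finset.prod_mul_distrib, ← Finset.prod_mul_distrib, ← Finset.prod_mul_distrib, ← Finset.prod_mul_distrib, ← Finset.prod_mul_distrib, ← Finset.prod_mul_distrib]
    refine Finset.prod_congr rfl fun i _ => ?_
    obtain ⟨-, -, -, hD, -, -, hAD, -, hBD, hCD, -, hABD, hACD, hBCD, hABCD⟩ := regions i
    by_cases xA : i ∈ A <;> by_cases xB : i ∈ B <;> by_cases xC : i ∈ C <;> by_cases xD : i ∈ D <;>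
      simp [hD, hAD, hBD, hCD, hABD, hACD, hBCD, hABCD, xA, xB, xC, xD]
  have fAB : ∏ i ∈ A ∪ B, q i = (∏ i ∈ gA, q i) * (∏ i ∈ gB, q i) * (∏ i ∈ gAB, q i) * (∏ i ∈ gAC, q i) * (∏ i ∈ gAD, q i) * (∏ i ∈ gBC, q i) * (∏ i ∈ gBD, q i) * (∏ i ∈ gABC, q i) * (∏ i ∈ gABD, q i) * (∏ i ∈ gACD, q i) * (∏ i ∈ gBCD, q i) * (∏ i ∈ gABCD, q i) := by
    rw [eU sAB, eU sgA, eU sgB, eU sgAB, eU sgAC, eU sgAD, eU sgBC, eU sgBD, eU sgABC, eU sgABD, eU sgACD, eU sgBCD, eU sgABCD, ← Finset.prod_mul_distrib, ← Finset.prod_mul_distrib, ← Finset.prod_mul_distrib, ← Finset.prod_mul_distrib, ← Finset.prod_mul_distrib, ← Finset.prod_mul_distrib, ← Finset.prod_mul_distrib, ← Finset.prod_mul_distrib, ← Finset.prod_mul_distrib, ← Finset.prod_mul_distrib, ← Finset.prod_mul_distrib]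
    refine Finset.prod_congr rfl fun i _ => ?_
    obtain ⟨hA, hB, -, -, hAB, hAC, hAD, hBC, hBD, -, hABC, hABD, hACD, hBCD, hABCD⟩ := regions i
    by_cases xA : i ∈ A <;> by_cases xB : i ∈ B <;> by_cases xC : i ∈ C <;> by_cases xD : i ∈ D <;>
      simp [hA, hB, hAB, hAC, hAD, hBC, hBD, hABC, hABD, hACD, hBCD, hABCD, xA, xB, xC, xD, Finset.mem_union]
  have fAC : ∏ i ∈ A ∪ C, q i = (∏ i ∈ gA, q i) * (∏ i ∈ gC, q i) * (∏ i ∈ gAB, q i) * (∏ i ∈ gAC, q i) * (∏ i ∈ gAD, q i) * (∏ i ∈ gBC, q i) * (∏ i ∈ gCD, q i) * (∏ i ∈ gABC, q i) * (∏ i ∈ gABD, q i) * (∏ i ∈ gACD, q i) * (∏ i ∈ gBCD, q i) * (∏ i ∈ gABCD, q i) := by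
    rw [eU sAC, eU sgA, eU sgC, eU sgAB, eU sgAC, eU sgAD, eU sgBC, eU sgCD, eU sgABC, eU sgABD, eU sgACD, eU sgBCD, eU sgABCD, ← Finset.prod_mul_distrib, ← Finset.prod_mul_distrib, ← Finset.prod_mul_distrib, ← Finset.prod_mul_distrib, ← Finset.prod_mul_distrib, ← Finset.prod_mul_distrib, ← Finset.prod_mul_distrib, ← Finset.prod_mul_distrib, ← Finset.prod_mul_distrib, ← Finset.prod_mul_distrib, ← Finset.prod_mul_distrib]
    refine Finset.prod_congr rfl fun i _ => ?_
    obtain ⟨hA, -, hC, -, hAB, hAC, hAD, hBC, -, hCD, hABC, hABD, hACD, hBCD, hABCD⟩ := regions i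
    by_cases xA : i ∈ A <;> by_cases xB : i ∈ B <;> by_cases xC : i ∈ C <;> by_cases xD : i ∈ D <;>
      simp [hA, hC, hAB, hAC, hAD, hBC, hCD, hABC, hABD, hACD, hBCD, hABCD, xA, xB, xC, xD, Finset.mem_union]
  have fAD : ∏ i ∈ A ∪ D, q i = (∏ i ∈ gA, q i) * (∏ i ∈ gD, q i) * (∏ i ∈ gAB, q i) * (∏ i ∈ gAC, q i) * (∏ i ∈ gAD, q i) * (∏ i ∈ gBD, q i) * (∏ i ∈ gCD, q i) * (∏ i ∈ gABC, q i) * (∏ i ∈ gABD, q i) * (∏ i ∈ gACD, q i) * (∏ i ∈ gBCD, q i) * (∏ i ∈ gABCD, q i) := by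
    rw [eU sAD, eU sgA, eU sgD, eU sgAB, eU sgAC, eU sgAD, eU sgBD, eU sgCD, eU sgABC, eU sgABD, eU sgACD, eU sgBCD, eU sgABCD, ← Finset.prod_mul_distrib, ← Finset.prod_mul_distrib, ← Finset.prod_mul_distrib, ← Finset.prod_mul_distrib, ← Finset.prod_mul_distrib, ← Finset.prod_mul_distrib, ← Finset.prod_mul_distrib, ← Finset.prod_mul_distrib, ← Finset.prod_mul_distrib, ← Finset.prod_mul_distrib, ← Finset.prod_mul_distrib]
    refine Finset.prod_congr rfl fun i _ => ?_
    obtain ⟨hA, -, -, hD, hAB, hAC, hAD, -, hBD, hCD, hABC, hABD, hACD, hBCD, hABCD⟩ := regions i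
    by_cases xA : i ∈ A <;> by_cases xB : i ∈ B <;> by_cases xC : i ∈ C <;> by_cases xD : i ∈ D <;>
      simp [hA, hD, hAB, hAC, hAD, hBD, hCD, hABC, hABD, hACD, hBCD, hABCD, xA, xB, xC, xD, Finset.mem_union]
  have fBC : ∏ i ∈ B ∪ C, q i = (∏ i ∈ gB, q i) * (∏ i ∈ gC, q i) * (∏ i ∈ gAB, q i) * (∏ i ∈ gAC, q i) * (∏ i ∈ gBC, q i) * (∏ i ∈ gBD, q i) * (∏ i ∈ gCD, q i) * (∏ i ∈ gABC, q i) * (∏ i ∈ gABD, q i) * (∏ i ∈ gACD, q i) * (∏ i ∈ gBCD, q i) * (∏ i ∈ gABCD, q i) := by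
    rw [eU sBC, eU sgB, eU sgC, eU sgAB, eU sgAC, eU sgBC, eU sgBD, eU sgCD, eU sgABC, eU sgABD, eU sgACD, eU sgBCD, eU sgABCD, ← Finset.prod_mul_distrib, ← Finset.prod_mul_distrib, ← Finset.prod_mul_distrib, ← Finset.prod_mul_distrib, ← Finset.prod_mul_distrib, ← Finset.prod_mul_distrib, ← Finset.prod_mul_distrib, ← Finset.prod_mul_distrib, ← Finset.prod_mul_distrib, ← Finset.prod_mul_distrib, ← Finset.prod_mul_distrib]
    refine Finset.prod_congr rfl fun i _ => ?_
    obtain ⟨-, hB, hC, -, hAB, hAC, -, hBC, hBD, hCD, hABC, hABD, hACD, hBCD, hABCD⟩ := regions i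
    by_cases xA : i ∈ A <;> by_cases xB : i ∈ B <;> by_cases xC : i ∈ C <;> by_cases xD : i ∈ D <;>
      simp [hB, hC, hAB, hAC, hBC, hBD, hCD, hABC, hABD, hACD, hBCD, hABCD, xA, xB, xC, xD, Finset.mem_union]
  have fBD : ∏ i ∈ B ∪ D, q i = (∏ i ∈ gB, q i) * (∏ i ∈ gD, q i) * (∏ i ∈ gAB, q i) * (∏ i ∈ gAD, q i) * (∏ i ∈ gBC, q i) * (∏ i ∈ gBD, q i) * (∏ i ∈ gCD, q i) * (∏ i ∈ gABC, q i) * (∏ i ∈ gABD, q i) * (∏ i ∈ gACD, q i) * (∏ i ∈ gBCD, q i) * (∏ i ∈ gABCD, q i) := by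
    rw [eU sBD, eU sgB, eU sgD, eU sgAB, eU sgAD, eU sgBC, eU sgBD, eU sgCD, eU sgABC, eU sgABD, eU sgACD, eU sgBCD, eU sgABCD, ← Finset.prod_mul_distrib, ← Finset.prod_mul_distrib, ← Finset.prod_mul_distrib, ← Finset.prod_mul_distrib, ← Finset.prod_mul_distrib, ← Finset.prod_mul_distrib, ← Finset.prod_mul_distrib, ← Finset.prod_mul_distrib, ← Finset.prod_mul_distrib, ← Finset.prod_mul_distrib, ← Finset.prod_mul_distrib]
    refine Finset.prod_congr rfl fun i _ => ?_
    obtain ⟨-, hB, -, hD, hAB, -, hAD, hBC, hBD, hCD, hABC, hABD, hACD, hBCD, hABCD⟩ := regions i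
    by_cases xA : i ∈ A <;> by_cases xB : i ∈ B <;> by_cases xC : i ∈ C <;> by_cases xD : i ∈ D <;>
      simp [hB, hD, hAB, hAD, hBC, hBD, hCD, hABC, hABD, hACD, hBCD, hABCD, xA, xB, xC, xD, Finset.mem_union]
  have fCD : ∏ i ∈ C ∪ D, q i = (∏ i ∈ gC, q i) * (∏ i ∈ gD, q i) * (∏ i ∈ gAC, q i) * (∏ i ∈ gAD, q i) * (∏ i ∈ gBC, q i) * (∏ i ∈ gBD, q i) * (∏ i ∈ gCD, q i) * (∏ i ∈ gABC, q i) * (∏ i ∈ gABD, q i) * (∏ i ∈ gACD, q i) * (∏ i ∈ gBCD, q i) * (∏ i ∈ gABCD, q i) := by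
    rw [eU sCD, eU sgC, eU sgD, eU sgAC, eU sgAD, eU sgBC, eU sgBD, eU sgCD, eU sgABC, eU sgABD, eU sgACD, eU sgBCD, eU sgABCD, ← Finset.prod_mul_distrib, ← Finset.prod_mul_distrib, ← Finset.prod_mul_distrib, ← Finset.prod_mul_distrib, ← Finset.prod_mul_distrib, ← Finset.prod_mul_distrib, ← Finset.prod_mul_distrib, ← Finset.prod_mul_distrib, ← Finset.prod_mul_distrib, ← Finset.prod_mul_distrib, ← Finset.prod_mul_distrib]
    refine Finset.prod_congr rfl fun i _ => ?_
    obtain ⟨-, -, hC, hD, -, hAC, hAD, hBC, hBD, hCD, hABC, hABD, hACD, hBCD, hABCD⟩ := regions i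
    by_cases xA : i ∈ A <;> by_cases xB : i ∈ B <;> by_cases xC : i ∈ C <;> by_cases xD : i ∈ D <;>
      simp [hC, hD, hAC, hAD, hBC, hBD, hCD, hABC, hABD, hACD, hBCD, hABCD, xA, xB, xC, xD, Finset.mem_union]
  have fABC : ∏ i ∈ A ∪ B ∪ C, q i = (∏ i ∈ gA, q i) * (∏ i ∈ gB, q i) * (∏ i ∈ gC, q i) * (∏ i ∈ gAB, q i) * (∏ i ∈ gAC, q i) * (∏ i ∈ gAD, q i) * (∏ i ∈ gBC, q i) * (∏ i ∈ gBD, q i) * (∏ i ∈ gCD, q i) * (∏ i ∈ gABC, q i) * (∏ i ∈ gABD, q i) * (∏ i ∈ gACD, q i) * (∏ i ∈ gBCD, q i) * (∏ i ∈ gABCD, q i) := by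
    rw [eU sABC, eU sgA, eU sgB, eU sgC, eU sgAB, eU sgAC, eU sgAD, eU sgBC, eU sgBD, eU sgCD, eU sgABC, eU sgABD, eU sgACD, eU sgBCD, eU sgABCD, ← Finset.prod_mul_distrib, ← Finset.prod_mul_distrib, ← Finset.prod_mul_distrib, ← Finset.prod_mul_distrib, ← Finset.prod_mul_distrib, ← Finset.prod_mul_distrib, ← Finset.prod_mul_distrib, ← Finset.prod_mul_distrib, ← Finset.prod_mul_distrib, ← Finset.prod_mul_distrib, ← Finset.prod_mul_distrib, ← Finset.prod_mul_distrib, ← Finset.prod_mul_distrib]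
    refine Finset.prod_congr rfl fun i _ => ?_
    obtain ⟨hA, hB, hC, -, hAB, hAC, hAD, hBC, hBD, hCD, hABC, hABD, hACD, hBCD, hABCD⟩ := regions i
    by_cases xA : i ∈ A <;> by_cases xB : i ∈ B <;> by_cases xC : i ∈ C <;> by_cases xD : i ∈ D <;>
      simp [hA, hB, hC, hAB, hAC, hAD, hBC, hBD, hCD, hABC, hABD, hACD, hBCD, hABCD, xA, xB, xC, xD, Finset.mem_union]
  have fABD : ∏ i ∈ A ∪ B ∪ D, q i = (∏ i ∈ gA, q i) * (∏ i ∈ gB, q i) * (∏ i ∈ gD, q i) * (∏ i ∈ gAB, q i) * (∏ i ∈ gAC, q i) * (∏ i ∈ gAD, q i) * (∏ i ∈ gBC, q i) * (∏ i ∈ gBD, q i) * (∏ i ∈ gCD, q i) * (∏ i ∈ gABC, q i) * (∏ i ∈ gABD, q i) * (∏ i ∈ gACD, q i) * (∏ i ∈ gBCD, q i) * (∏ i ∈ gABCD, q i) := by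
    rw [eU sABD, eU sgA, eU sgB, eU sgD, eU sgAB, eU sgAC, eU sgAD, eU sgBC, eU sgBD, eU sgCD, eU sgABC, eU sgABD, eU sgACD, eU sgBCD, eU sgABCD, ← Finset.prod_mul_distrib, ← Finset.prod_mul_distrib, ← Finset.prod_mul_distrib, ← Finset.prod_mul_distrib, ← Finset.prod_mul_distrib, ← Finset.prod_mul_distrib, ← Finset.prod_mul_distrib, ← Finset.prod_mul_distrib, ← Finset.prod_mul_distrib, ← Finset.prod_mul_distrib, ← Finset.prod_mul_distrib, ← Finset.prod_mul_distrib, ← Finset.prod_mul_distrib]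
    refine Finset.prod_congr rfl fun i _ => ?_
    obtain ⟨hA, hB, -, hD, hAB, hAC, hAD, hBC, hBD, hCD, hABC, hABD, hACD, hBCD, hABCD⟩ := regions i
    by_cases xA : i ∈ A <;> by_cases xB : i ∈ B <;> by_cases xC : i ∈ C <;> by_cases xD : i ∈ D <;>
      simp [hA, hB, hD, hAB, hAC, hAD, hBC, hBD, hCD, hABC, hABD, hACD, hBCD, hABCD, xA, xB, xC, xD, Finset.mem_union]
  have fACD : ∏ i ∈ A ∪ C ∪ D, q i = (∏ i ∈ gA, q i) * (∏ i ∈ gC, q i) * (∏ i ∈ gD, q i) * (∏ i ∈ gAB, q i) * (∏ i ∈ gAC, q i) * (∏ i ∈ gAD, q i) * (∏ i ∈ gBC, q i) * (∏ i ∈ gBD, q i) * (∏ i ∈ gCD, q i) * (∏ i ∈ gABC, q i) * (∏ i ∈ gABD, q i) * (∏ i ∈ gACD, q i) * (∏ i ∈ gBCD, q i) * (∏ i ∈ gABCD, q i) := by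
    rw [eU sACD, eU sgA, eU sgC, eU sgD, eU sgAB, eU sgAC, eU sgAD, eU sgBC, eU sgBD, eU sgCD, eU sgABC, eU sgABD, eU sgACD, eU sgBCD, eU sgABCD, ← Finset.prod_mul_distrib, ← Finset.prod_mul_distrib, ← Finset.prod_mul_distrib, ← Finset.prod_mul_distrib, ← Finset.prod_mul_distrib, ← Finset.prod_mul_distrib, ← Finset.prod_mul_distrib, ← Finset.prod_mul_distrib, ← Finset.prod_mul_distrib, ← Finset.prod_mul_distrib, ← Finset.prod_mul_distrib, ← Finset.prod_mul_distrib, ← Finset.prod_mul_distrib]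
    refine Finset.prod_congr rfl fun i _ => ?_
    obtain ⟨hA, -, hC, hD, hAB, hAC, hAD, hBC, hBD, hCD, hABC, hABD, hACD, hBCD, hABCD⟩ := regions i
    by_cases xA : i ∈ A <;> by_cases xB : i ∈ B <;> by_cases xC : i ∈ C <;> by_cases xD : i ∈ D <;>
      simp [hA, hC, hD, hAB, hAC, hAD, hBC, hBD, hCD, hABC, hABD, hACD, hBCD, hABCD, xA, xB, xC, xD, Finset.mem_union]
  have fBCD : ∏ i ∈ B ∪ C ∪ D, q i = (∏ i ∈ gB, q i) * (∏ i ∈ gC, q i) * (∏ i ∈ gD, q i) * (∏ i ∈ gAB, q i) * (∏ i ∈ gAC, q i) * (∏ i ∈ gAD, q i) * (∏ i ∈ gBC, q i) * (∏ i ∈ gBD, q i) * (∏ i ∈ gCD, q i) * (∏ i ∈ gABC, q i) * (∏ i ∈ gABD, q i) * (∏ i ∈ gACD, q i) * (∏ i ∈ gBCD, q i) * (∏ i ∈ gABCD, q i) := by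
    rw [eU sBCD, eU sgB, eU sgC, eU sgD, eU sgAB, eU sgAC, eU sgAD, eU sgBC, eU sgBD, eU sgCD, eU sgABC, eU sgABD, eU sgACD, eU sgBCD, eU sgABCD, ← Finset.prod_mul_distrib, ← Finset.prod_mul_distrib, ← Finset.prod_mul_distrib, ← Finset.prod_mul_distrib, ← Finset.prod_mul_distrib, ← Finset.prod_mul_distrib, ← Finset.prod_mul_distrib, ← Finset.prod_mul_distrib, ← Finset.prod_mul_distrib, ← Finset.prod_mul_distrib, ← Finset.prod_mul_distrib, ← Finset.prod_mul_distrib, ← Finset.prod_mul_distrib]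
    refine Finset.prod_congr rfl fun i _ => ?_
    obtain ⟨-, hB, hC, hD, hAB, hAC, hAD, hBC, hBD, hCD, hABC, hABD, hACD, hBCD, hABCD⟩ := regions i
    by_cases xA : i ∈ A <;> by_cases xB : i ∈ B <;> by_cases xC : i ∈ C <;> by_cases xD : i ∈ D <;>
      simp [hB, hC, hD, hAB, hAC, hAD, hBC, hBD, hCD, hABC, hABD, hACD, hBCD, hABCD, xA, xB, xC, xD, Finset.mem_union]
  have fABCD : ∏ i ∈ A ∪ B ∪ C ∪ D, q i = (∏ i ∈ gA, q i) * (∏ i ∈ gB, q i) * (∏ i ∈ gC, q i) * (∏ i ∈ gD, q i) * (∏ i ∈ gAB, q i) * (∏ i ∈ gAC, q i) * (∏ i ∈ gAD, q i) * (∏ i ∈ gBC, q i) * (∏ i ∈ gBD, q i) * (∏ i ∈ gCD, q i) * (∏ i ∈ gABC, q i) * (∏ i ∈ gABD, q i) * (∏ i ∈ gACD, q i) * (∏ i ∈ gBCD, q i) * (∏ i ∈ gABCD, q i) := by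
    rw [eU sABCD, eU sgA, eU sgB, eU sgC, eU sgD, eU sgAB, eU sgAC, eU sgAD, eU sgBC, eU sgBD, eU sgCD, eU sgABC, eU sgABD, eU sgACD, eU sgBCD, eU sgABCD, ← Finset.prod_mul_distrib, ← Finset.prod_mul_distrib, ← Finset.prod_mul_distrib, ← Finset.prod_mul_distrib, ← Finset.prod_mul_distrib, ← Finset.prod_mul_distrib, ← Finset.prod_mul_distrib, ← Finset.prod_mul_distrib, ← Finset.prod_mul_distrib, ← Finset.prod_mul_distrib, ← Finset.prod_mul_distrib, ← Finset.prod_mul_distrib, ← Finset.prod_mul_distrib, ← Finset.prod_mul_distrib]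
    refine Finset.prod_congr rfl fun i _ => ?_
    obtain ⟨hA, hB, hC, hD, hAB, hAC, hAD, hBC, hBD, hCD, hABC, hABD, hACD, hBCD, hABCD⟩ := regions i
    by_cases xA : i ∈ A <;> by_cases xB : i ∈ B <;> by_cases xC : i ∈ C <;> by_cases xD : i ∈ D <;>
      simp [hA, hB, hC, hD, hAB, hAC, hAD, hBC, hBD, hCD, hABC, hABD, hACD, hBCD, hABCD, xA, xB, xC, xD, Finset.mem_union]
  -- complements and the complementation identity
  have mA := SahiInfiniteVolume.measurableSet_disjoint_finset (ι := ι) A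
  have mB := SahiInfiniteVolume.measurableSet_disjoint_finset (ι := ι) B
  have mC := SahiInfiniteVolume.measurableSet_disjoint_finset (ι := ι) C
  have mD := SahiInfiniteVolume.measurableSet_disjoint_finset (ι := ι) D
  rw [hit_eq_compl_miss A, hit_eq_compl_miss B, hit_eq_compl_miss C, hit_eq_compl_miss D,
    sahiE4_compl (prodBernoulli p) mA mB mC mD, sahiE4_def, sahiE3_def, sahiE3_def, sahiE3_def, sahiE3_def]
  simp only [miss_inter_miss, prodBernoulli_real_forall_notMem]
  simp only [← hq]
  exact sahiE4_fifteenRegion_nonneg fA fB fC fD fAB fAC fAD fBC fBD fCD fABC fABD fACD fBCD fABCD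
    (P0 _) (P1 _) (P0 _) (P1 _) (P0 _) (P1 _) (P0 _) (P1 _) (P0 _) (P1 _) (P0 _) (P1 _) (P0 _) (P1 _) (P0 _) (P1 _) (P0 _) (P1 _) (P0 _) (P1 _) (P0 _) (P1 _) (P0 _) (P1 _) (P0 _) (P1 _) (P0 _) (P1 _) (P0 _) (P1 _)

end SahiHitting

end Summit.CriticalPhenomena.PercolationContinuityZ3.Theorems
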